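import Summits.NavierStokesRegularity.FluidComputer.PalasekTowerClayBridgeWS
import Literature.Analysis.FluidPDE.TaoForcedNormalisedPressureDischarge
import Literature.Analysis.FluidPDE.NSSerrinUniquenessForced
import HarnessLib

/-!
# The E–C bridge, PATH B′: `PalasekStep2 R ⇒ NavierStokesBreakdownR3` with NO named-fact hypothesis
# (sibling of `PalasekTowerClayBridgeWS`, whose closers are conditional on the Sohr fact `hSM` and on `hP`)

HONEST FRAMING (cell `ns-blowup`; seats `ns-blowup-ecbridge-2` g2 (PATH B packaging,
`PalasekTowerClayBridgeWS.lean`), `ns-blowup-lean` g3 (the forced Serrin–Masuda theorem F1–F3) and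
g4 (this file); planner RULINGS STATUS l.1660 «PATH B′ = binder-free closer» and 03:34Z (β); human
ruling D-0035). WHAT THIS IS NOT: not NS — no construction; the crux `PalasekStep2` (Palasek's open
Step 2, arXiv:2605.13827 §4) stays a hypothesis. The sibling `PalasekTowerClayBridgeWS` proves
`navierStokesBreakdownR3_of_step2_ws : hSM → hP → PalasekStep2 R → NavierStokesBreakdownR3` with the two
printed facts `hSM : sohr2001_serrinMasuda_uniqueness_forced` (Sohr V.1.5.1, retired from the route's
glue by planner RULING 02:53Z: its unguarded force class carries a junk surplus, refuter KJ-1) and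
`hP : tao2011_forced_pressure_normalisation_ae`. Here BOTH are discharged by THEOREMS of the tree:

* `hP := tao2011_forced_pressure_normalisation_ae_holds` (`TaoForcedNormalisedPressureDischarge.lean`),
  fed to the sibling's `hP`-conditional packaging `isLerayHopfOn_of_clayForce'` /
  `isGlobalLerayHopf_of_claySolution'` (finite-energy classical solutions with a Clay force are
  Leray–Hopf);
* `hSM` := the forced Serrin–Masuda weak–strong uniqueness THEOREM
  `serrinMasuda_weak_strong_uniqueness_forced_L4L6` (`NSSerrinUniquenessForced.lean`; Sohr 2001
  Thm. V.1.5.1 on `ℝ³` in the honest force class `f ∈ L²((0,T')×ℝ³)` a.e. jointly measurable) — a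
  Clay force is in that class on every slab (`clayForce_aestronglyMeasurable_prod'`,
  `clayForce_eLpNorm_prod_lt_top'`: continuity on `[0,∞)×ℝ³`; `‖f‖²_{L²((0,T)×ℝ³)} ≤ C₀·T` from
  `ClayForceSliceBounds.clayForce_slice_bounds`).

Chain: `clay_competitor_eq_of_serrinClass_B` (designed classical solution in `L⁴(0,T';L⁶)` for all
`T' < T` = any Clay competitor on the slab) → `Realisation.eq_of_claySolution_B` →
`Realisation.not_exists_claySolution_B` (the floors forbid continuity on the box,
`Realisation.false_of_continuousOn_box`) → **`navierStokesBreakdownR3_of_step2_B (R) : PalasekStep2 R →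
NavierStokesBreakdownR3`** (+ Literature spelling, + one-realisation form), conditional on the crux ONLY.
-/

noncomputable section

namespace Summit.NavierStokesRegularity.FluidComputer.PalasekTowerClayBridge

open Set MeasureTheory Filter Topology Function
open scoped ENNReal ContDiff NNReal
open Literature.Analysis.FluidPDE
open Summit.NavierStokesRegularity.NavierStokesRegularity
open Summit.NavierStokesRegularity.FluidComputer.ClayForcedLerayHopf

section PathBprime


/-- **A Clay-class force is a.e. jointly strongly measurable on every slab `(0,T) × ℝ³`** (it is
continuous on `[0,∞) × ℝ³ ⊇ (0,T) × ℝ³`). -/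
theorem clayForce_aestronglyMeasurable_prod'
    {f : ℝ → EuclideanSpace ℝ (Fin 3) → EuclideanSpace ℝ (Fin 3)} (hs : IsSmoothOnHalfSpace f)
    (T : ℝ) :
    AEStronglyMeasurable (uncurry f)
      (((volume : Measure ℝ).restrict (Ioo 0 T)).prod (volume : Measure (EuclideanSpace ℝ (Fin 3)))) := by
  have e : ((volume : Measure ℝ).restrict (Ioo 0 T)).prod (volume : Measure (EuclideanSpace ℝ (Fin 3))) =
      (volume : Measure (ℝ × EuclideanSpace ℝ (Fin 3))).restrict (Ioo 0 T ×ˢ univ) := by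
    rw [Measure.volume_eq_prod, ← Measure.prod_restrict, Measure.restrict_univ]
  rw [e]
  have hc : ContinuousOn (uncurry f) (Ioo 0 T ×ˢ (univ : Set (EuclideanSpace ℝ (Fin 3)))) :=
    hs.continuousOn.mono (prod_mono (fun t ht => le_of_lt ht.1) subset_rfl)
  exact hc.aestronglyMeasurable (measurableSet_Ioo.prod MeasurableSet.univ)

/-- **A Clay-class force is square integrable on every slab `(0,T) × ℝ³`**: its slices obey
`∫⁻‖f t‖ₑ² ≤ C₀` uniformly in `t ≥ 0` (`ClayForceSliceBounds.clayForce_slice_bounds`), so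
`‖f‖²_{L²((0,T)×ℝ³)} ≤ C₀ · T` (Tonelli). -/
theorem clayForce_eLpNorm_prod_lt_top'
    {f : ℝ → EuclideanSpace ℝ (Fin 3) → EuclideanSpace ℝ (Fin 3)} (hs : IsSmoothOnHalfSpace f)
    (hd : HasRapidSpaceTimeDecay f) (T : ℝ) :
    eLpNorm (uncurry f) 2
      (((volume : Measure ℝ).restrict (Ioo 0 T)).prod (volume : Measure (EuclideanSpace ℝ (Fin 3)))) < ⊤ := by
  obtain ⟨⟨C₀, hC₀⟩, -⟩ := ClayForceSliceBounds.clayForce_slice_bounds hs hd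
  have hm := clayForce_aestronglyMeasurable_prod' hs T
  have h2 : ∫⁻ z, ‖uncurry f z‖ₑ ^ 2
      ∂(((volume : Measure ℝ).restrict (Ioo 0 T)).prod (volume : Measure (EuclideanSpace ℝ (Fin 3))))
      ≤ C₀ * ENNReal.ofReal T := by
    rw [lintegral_prod _ (hm.enorm.pow_const _)]
    calc ∫⁻ t in Ioo 0 T, ∫⁻ x, ‖uncurry f (t, x)‖ₑ ^ 2
        ≤ ∫⁻ t in Ioo 0 T, (C₀ : ℝ≥0∞) := by
          refine lintegral_mono_ae ?_
          filter_upwards [ae_restrict_mem measurableSet_Ioo] with t ht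
          exact hC₀ t ht.1.le
      _ = C₀ * ENNReal.ofReal T := by
          rw [lintegral_const, Measure.restrict_apply_univ, Real.volume_Ioo, sub_zero]
  rw [eLpNorm_eq_lintegral_rpow_enorm_toReal two_ne_zero ENNReal.ofNat_ne_top, ENNReal.toReal_ofNat]
  refine ENNReal.rpow_lt_top_of_nonneg (by norm_num) (ne_of_lt ?_)
  have e : ∫⁻ z, ‖uncurry f z‖ₑ ^ (2 : ℝ)
      ∂(((volume : Measure ℝ).restrict (Ioo 0 T)).prod (volume : Measure (EuclideanSpace ℝ (Fin 3)))) =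
      ∫⁻ z, ‖uncurry f z‖ₑ ^ 2
      ∂(((volume : Measure ℝ).restrict (Ioo 0 T)).prod (volume : Measure (EuclideanSpace ℝ (Fin 3)))) := by
    refine lintegral_congr fun z => ?_
    rw [show (2 : ℝ) = ((2 : ℕ) : ℝ) by norm_num, ENNReal.rpow_natCast]
  rw [e]
  exact lt_of_le_of_lt h2 (ENNReal.mul_lt_top ENNReal.coe_lt_top ENNReal.ofReal_lt_top)

/-- **THE PATH B′ CLOSING LEMMA — no named fact.** Let `f` be a Clay-class force, `(w, q)` a
classical solution of the forced system on the closed slab `[0, T] × ℝ³` with `sup_t ∫|w(t)|² < ∞`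
lying in `L⁴(0,T'; L⁶)` for every `T' < T` (the DESIGNED solution), and `(v, r)` ANY Clay solution on
`[0, ∞)` (Fefferman (1)–(3), (6)–(7)) from the same datum `w 0`. Then `v = w` on `[0, T] × ℝ³`:
both are Leray–Hopf with force `f` (by the THEOREM `tao2011_forced_pressure_normalisation_ae_holds`
through the `hP`-conditional packaging `isLerayHopfOn_of_clayForce'` /
`isGlobalLerayHopf_of_claySolution'`), the force is a.e. jointly measurable and in
`L²((0,T) × ℝ³)`, and the forced Serrin–Masuda weak–strong uniqueness THEOREM identifies them;
continuity upgrades a.e. to everywhere and reaches the endpoints. -/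
theorem clay_competitor_eq_of_serrinClass_B
    {ν T : ℝ} {f w v : ℝ → EuclideanSpace ℝ (Fin 3) → EuclideanSpace ℝ (Fin 3)}
    {q r : ℝ → EuclideanSpace ℝ (Fin 3) → ℝ}
    (hν : 0 < ν) (hT : 0 < T) (hs : IsSmoothOnHalfSpace f) (hd : HasRapidSpaceTimeDecay f)
    (hw : IsClassicalNSSolutionOn (Icc 0 T) ν f w q)
    (hwE : ∃ A : ℝ≥0∞, A < ⊤ ∧ ∀ t ∈ Icc 0 T, ∫⁻ x, ‖w t x‖ₑ ^ 2 ≤ A)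
    (hS : ∀ T', 0 < T' → T' < T → MemLqLp 4 6 w (Ioo 0 T'))
    (hsol : IsNavierStokesSolution ν f (w 0) v r) (hv : IsSmoothOnHalfSpace v)
    (hr : IsSmoothOnHalfSpace r) (hvE : HasBoundedEnergy v) :
    ∀ t ∈ Icc 0 T, v t = w t := by
  have hP : tao2011_forced_pressure_normalisation_ae := tao2011_forced_pressure_normalisation_ae_holds
  have hLHv : IsLerayHopfOn T ν f (w 0) v :=
    (isGlobalLerayHopf_of_claySolution' hP hν hs hd hsol hv hr hvE).1 T hT
  have hLHw : IsLerayHopfOn T ν f (w 0) w := (isLerayHopfOn_of_clayForce' hP hw hν hT hs hd hwE).1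
  have hw₀ : MemLp (w 0) 2 volume := hLHw.memLp 0 ⟨le_rfl, hT.le⟩
  have hae : ∀ t ∈ Ioo 0 T, w t =ᵐ[volume] v t :=
    serrinMasuda_weak_strong_uniqueness_forced_L4L6 hν hw₀
      (fun T' _ _ => clayForce_aestronglyMeasurable_prod' hs T')
      (fun T' _ _ => clayForce_eLpNorm_prod_lt_top' hs hd T') hLHv hLHw hS
  obtain ⟨hcl, -⟩ := isNavierStokesSolution_and_smooth_iff.1 ⟨hsol, hv, hr⟩
  have hvT : IsClassicalNSSolutionOn (Icc 0 T) ν f v r :=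
    hcl.mono Icc_subset_Ici_self (uniqueDiffOn_Icc hT)
  have hIoo : ∀ t ∈ Ioo 0 T, v t = w t := by
    intro t ht
    have htI : t ∈ Icc 0 T := Ioo_subset_Icc_self ht
    exact ((Continuous.ae_eq_iff_eq volume (hvT.contDiff_velocity htI).continuous
      (hw.contDiff_velocity htI).continuous).1 (hae t ht).symm)
  intro t ht
  funext x
  have hcv : ContinuousOn (fun s => v s x) (Icc 0 T) :=
    hvT.smooth_velocity.continuousOn.comp ((continuous_id.prodMk continuous_const).continuousOn)
      fun s hs => mk_mem_prod hs (mem_univ x)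
  have hcw : ContinuousOn (fun s => w s x) (Icc 0 T) :=
    hw.smooth_velocity.continuousOn.comp ((continuous_id.prodMk continuous_const).continuousOn)
      fun s hs => mk_mem_prod hs (mem_univ x)
  have hEq : EqOn (fun s => v s x) (fun s => w s x) (Ioo 0 T) := fun s hs => by
    simp only [hIoo s hs]
  have hcl' : Icc 0 T ⊆ closure (Ioo 0 T) := by rw [closure_Ioo hT.ne]
  exact hEq.of_subset_closure hcv hcw Ioo_subset_Icc_self hcl' ht

namespace Realisation

variable {ν : ℝ} {R : TowerRates} (W : Realisation ν R)

/-- **Uniqueness against a global Clay-class solution — PATH B′, no named fact.** A solution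
`(v, q)` of the same forced system from the same datum, jointly smooth on `[0, ∞) × ℝ³` with
bounded energy, coincides with the tower on `[0, T)`: for `0 ≤ t < T` apply
`clay_competitor_eq_of_serrinClass_B` on the closed slab `[0, t']`, `t < t' < T`, where the designed
solution is classical, of finite energy and in `L⁴(0,·;L⁶)` (`memLqLp_four_six`). -/
theorem eq_of_claySolution_B (hν : 0 < ν)
    {v : ℝ → EuclideanSpace ℝ (Fin 3) → EuclideanSpace ℝ (Fin 3)}
    {q : ℝ → EuclideanSpace ℝ (Fin 3) → ℝ}
    (hv : IsSmoothOnHalfSpace v) (hq : IsSmoothOnHalfSpace q)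
    (hns : IsNavierStokesSolution ν W.f (W.u 0) v q) (hE : HasBoundedEnergy v) :
    ∀ t ∈ Ico 0 W.T, v t = W.u t := by
  intro t ht
  obtain ⟨ht0, htT⟩ := ht
  obtain ⟨t', htt', ht'T⟩ := exists_between htT
  have ht'0 : 0 < t' := lt_of_le_of_lt ht0 htt'
  have hu' : IsClassicalNSSolutionOn (Icc 0 t') ν W.f W.u W.p :=
    W.classical.mono (fun s hs => ⟨hs.1, lt_of_le_of_lt hs.2 ht'T⟩) (uniqueDiffOn_Icc ht'0)
  have hEu : ∃ C : ℝ≥0∞, C < ⊤ ∧ ∀ s ∈ Icc 0 t', ∫⁻ x, ‖W.u s x‖ₑ ^ 2 ≤ C := W.energy t' ht'T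
  have hS : ∀ T', 0 < T' → T' < t' → MemLqLp 4 6 W.u (Ioo 0 T') :=
    fun T' _ hT' => W.memLqLp_four_six ht'T hT'.le
  exact clay_competitor_eq_of_serrinClass_B hν ht'0 W.force_smooth W.force_decay hu' hEu hS
    hns hv hq hE t ⟨ht0, htt'.le⟩

/-- **No global Clay-class solution shares the tower's datum and force — PATH B′ form, no named
fact**: such a solution would coincide with the tower on `[0, T)` (`eq_of_claySolution_B`), yet it
is continuous on the compact box `[0, T] × B̄(0, radius)`, which the floors forbid
(`false_of_continuousOn_box`). -/
theorem not_exists_claySolution_B (hν : 0 < ν) :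
    ¬ ∃ (v : ℝ → EuclideanSpace ℝ (Fin 3) → EuclideanSpace ℝ (Fin 3))
        (q : ℝ → EuclideanSpace ℝ (Fin 3) → ℝ),
        IsSmoothOnHalfSpace v ∧ IsSmoothOnHalfSpace q ∧
          IsNavierStokesSolution ν W.f (W.u 0) v q ∧ HasBoundedEnergy v := by
  rintro ⟨v, q, hv, hq, hns, hE⟩
  have heq : ∀ t ∈ Ico 0 W.T, v t = W.u t := W.eq_of_claySolution_B hν hv hq hns hE
  refine W.false_of_continuousOn_box (v := v) ?_ heq
  have hsub : Icc (0 : ℝ) W.T ×ˢ Metric.closedBall (0 : EuclideanSpace ℝ (Fin 3)) W.radius ⊆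
      Ici (0 : ℝ) ×ˢ (univ : Set (EuclideanSpace ℝ (Fin 3))) :=
    prod_mono (fun s hs => hs.1) (subset_univ _)
  exact (ContDiffOn.continuousOn hv).mono hsub

end Realisation

/-- **THE E–C BRIDGE, PATH B′ FORM — `PalasekStep2 R → NavierStokesBreakdownR3` with NO named-fact
hypothesis.** If Palasek's Step 2 is realised for the rates `R` at every viscosity, then Fefferman's
breakdown statement (C) holds: at each `ν > 0` take `u₀ := u 0` and the tower's own force `f`; both
are of Clay class by the interface, and no smooth bounded-energy solution exists by
`Realisation.not_exists_claySolution_B` (forced Serrin–Masuda weak–strong uniqueness + Tao's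
forced pressure normalisation, both THEOREMS of the tree). Conditional on the crux ONLY. -/
theorem navierStokesBreakdownR3_of_step2_B (R : TowerRates) (h : PalasekStep2 R) :
    Summit.NavierStokesRegularity.NavierStokesRegularity.NavierStokesBreakdownR3 := by
  intro ν hν
  obtain ⟨W⟩ := h ν hν
  exact ⟨W.u 0, W.f, W.contDiff_datum, W.divFree_datum, W.datum_decay, W.force_smooth,
    W.force_decay, W.not_exists_claySolution_B hν⟩

/-- **THE E–C BRIDGE, PATH B′ FORM, Literature spelling of (C).** -/
theorem literature_navierStokesBreakdownR3_of_step2_B (R : TowerRates) (h : PalasekStep2 R) :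
    Literature.Analysis.FluidPDE.NavierStokesBreakdownR3 :=
  navierStokesBreakdownR3_iff_literature.1 (navierStokesBreakdownR3_of_step2_B R h)

/-- **The realisation form, PATH B′** (no `PalasekStep2` quantifier, no named fact): ONE realisation
at viscosity `ν` already gives the `ν`-instance of (C). -/
theorem navierStokesBreakdownR3_at_of_realisation_B {ν : ℝ} {R : TowerRates} (W : Realisation ν R)
    (hν : 0 < ν) :
    ∃ (u₀ : EuclideanSpace ℝ (Fin 3) → EuclideanSpace ℝ (Fin 3))
      (f : ℝ → EuclideanSpace ℝ (Fin 3) → EuclideanSpace ℝ (Fin 3)),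
      ContDiff ℝ ∞ u₀ ∧ NSWave0.IsDivFree u₀ ∧ HasRapidSpatialDecay u₀ ∧
      IsSmoothOnHalfSpace f ∧ HasRapidSpaceTimeDecay f ∧
        ¬ ∃ (u : ℝ → EuclideanSpace ℝ (Fin 3) → EuclideanSpace ℝ (Fin 3))
            (p : ℝ → EuclideanSpace ℝ (Fin 3) → ℝ),
            IsSmoothOnHalfSpace u ∧ IsSmoothOnHalfSpace p ∧
              IsNavierStokesSolution ν f u₀ u p ∧ HasBoundedEnergy u :=
  ⟨W.u 0, W.f, W.contDiff_datum, W.divFree_datum, W.datum_decay, W.force_smooth, W.force_decay,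
    W.not_exists_claySolution_B hν⟩

end PathBprime

end Summit.NavierStokesRegularity.FluidComputer.PalasekTowerClayBridge

end
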